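import Summits.QuantumFields.YangMills.Theorems.BalabanLadderIRTwistedSlabWeitzenboeck
import Summits.QuantumFields.YangMills.Theorems.BalabanLadderIRTwistedSlabZeroFormGap
import Literature.MathematicalPhysics.QuantumLattice.WilsonPlaquetteSecondVariation
import HarnessLib

/-!
# The Hessian of the twisted Wilson action of the `Fin` box at a twist-eating background IS the covariant curl form;
# Coulomb-gauge gap `4 sin²(π/(Nℓ₀))` at the decorated twist-eating ladders, uniformly in the long extents

HELPER toward stub **T1** `TwistedSlabAnchor` (LINE `twisted-slab-continuity`, crux `IRcof` stmt-QuantumFields-26930, census row 43;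
LEAD prover ym-ir-line-tsc-p1 g3; `--supports` the crux, `--as helper`).  Fourth file of the HOME HANDOFF item K3 («transversal
non-degeneracy of the classical vacua IN T1's OWN CURRENCY»); consumes `…TwistedSlabCovariantCalculus` ∕ `…TwistedSlabWeitzenboeck`
(covariant shifts, `weitzenboeck_finBox`, `coulomb_gap_of_zeroForm_gap`), `…TwistedSlabZeroFormGap` (`zeroForm_gap_ladder`) and lit-4's
`WilsonPlaquetteSecondVariation` (p664518: per-plaquette second variation at a centre-flat plaquette, BY NAME).
* §1 `linePlaq U a x μ ν t` — the plaquette holonomy of the LEFT-perturbed links `e^{t a_μ(x)} U(x,μ)` (lit-4's `plaqHol` with the four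
  background links and the four fluctuations of the plaquette `(x; μ, ν)` of the `Fin` box) and `lineAction U c a t = Σ_x Σ_{μ<ν}
  (N − Re tr(c_x(μ,ν) · linePlaq))` — for `c` = the phases of a centre-valued 't Hooft tensor this is LITERALLY the exponent of
  `wilsonFinTorusTensorTwistedPartition` in the defining representation along the line `t ↦ e^{ta}·U` (dictionary in the sequel file).
* §2 at a unitary background EATING the twist (`c_x(μ,ν) · P_U(x;μ,ν) = 1`, `|c| = 1`) and along skew-Hermitian `a`:
  `hasDerivAt_lineAction` (all `t`), `lineAction_zero` (`W(0) = 0`), `deriv_lineAction_zero` (`W'(0) = 0`: the eater is critical), ★★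
  `iteratedDeriv_two_lineAction`: `W''(0) = Σ_x Σ_{μ<ν} S(∇⁺_μ a_ν − ∇⁺_ν a_μ)(x)` — the Hessian of the twisted Wilson action of the box
  along the line IS the covariant curl form of `…TwistedSlabWeitzenboeck` (GPGAO's `G_{μν} = ∇⁺_μA_ν − ∇⁺_νA_μ`).
* §3 ★★ `lineAction_hessian_gap_of_zeroForm_gap`: phase-flat + a 0-form gap `m` ⇒ `m·Σ_x Σ_μ S(a_μ x) ≤ W''(0)` on traceless Coulomb-gauge `a`;
  ★★★ `ladder_hessian_gap`: at the decorated twist-eating ladder `ladderField ![A, B, c₂·1, c₃·1]` (`A, B` a unitary Weyl pair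
  `AB = ω·BA`, `ω` a primitive `N`-th root of unity, `|c₂| = |c₃| = 1`) of ANY box `(m+1) × (m+1) × n₂ × n₃`:
  `4 sin²(π/(N(m+1))) · Σ_x Σ_μ S(a_μ x) ≤ W''(0)` for every traceless skew-Hermitian `a` with `div a = 0` — the TRANSVERSAL MORSE–BOTT
  NON-DEGENERACY of the critical orbits of `…TwistedSlabVacuumOrbits` with a constant UNIFORM in the long extents `n₂, n₃`
  (tree-level input `A(p)` of `Literature.Analysis.Asymptotics.tendsto_laplaceMethod_fibred` for the T1-tree-exact roadmap, T1-ANATOMY §9.3).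

HONEST FRAMING: TREE-LEVEL statements on one box (the second variation along a line and its gap modulo gauge); no joint second-order
expansion with remainder, no interacting correction, nothing uniform in `β`; T1-box 0∕1, T1 proper (uniform exponential vacuum dominance
of the e₂-projected slab) 0∕1; nothing here bears on `IRcof`, `IR`, or the Yang–Mills mass gap (Clay: NOT proved); R4 = `BalabanLadder.UV`
only.  References: M. García Pérez, A. González-Arroyo, M. Okawa, JHEP 10 (2017) 150 = arXiv:1708.00841 §2.2–§2.5; IJMPA 29 (2014)
1445001 §3; H. Shen, R. Zhu, X. Zhu, CMP 400 (2023) 805, Lemma 4.1.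
-/

set_option autoImplicit false

noncomputable section

open scoped Matrix
open Finset NormedSpace
open Literature.MathematicalPhysics.QuantumFieldTheory Literature.MathematicalPhysics.QuantumLattice
open Literature.MathematicalPhysics.QuantumLattice.WilsonSecondVariation

namespace Summit.QuantumFields.YangMills.Cruxes.IRcof.TwistedSlab

variable {N : ℕ} {n₀ n₁ n₂ n₃ : ℕ}

/-! ## §1 The twisted Wilson action of the box along the line `t ↦ e^{t a} · U` -/

section Line

variable (U : FinTorusSite n₀ n₁ n₂ n₃ × Fin 4 → Matrix (Fin N) (Fin N) ℂ)
  (a : Fin 4 → FinTorusSite n₀ n₁ n₂ n₃ → Matrix (Fin N) (Fin N) ℂ)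

/-- The background plaquette `P_U(x; μ, ν) = U(x,μ) U(x+e_μ,ν) U(x+e_ν,μ)ᴴ U(x,ν)ᴴ` (unitary links: inverses are adjoints). [cite: Wilson1974] -/
def bgPlaq (x : FinTorusSite n₀ n₁ n₂ n₃) (μ ν : Fin 4) : Matrix (Fin N) (Fin N) ℂ :=
  U (x, μ) * U (x.shift μ, ν) * (U (x.shift ν, μ))ᴴ * (U (x, ν))ᴴ

/-- **The plaquette of the left-perturbed links** `e^{t a_μ(x)} U(x,μ)`: lit-4's `plaqHol` at the plaquette `(x; μ, ν)` of the `Fin` box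
(`Γ₁ = U(x,μ)`, `Γ₂ = U(x+e_μ,ν)`, `Γ₃ = U(x+e_ν,μ)`, `Γ₄ = U(x,ν)`; `X₁ = a_μ(x)`, `X₂ = a_ν(x+e_μ)`, `X₃ = a_μ(x+e_ν)`, `X₄ = a_ν(x)`).
[cite: GarciaperezGonzalezarroyoOkawa2017, §2.3 (2.3)] -/
def linePlaq (x : FinTorusSite n₀ n₁ n₂ n₃) (μ ν : Fin 4) (t : ℝ) : Matrix (Fin N) (Fin N) ℂ :=
  plaqHol (U (x, μ)) (U (x.shift μ, ν)) (U (x.shift ν, μ)) (U (x, ν)) (a μ x) (a ν (x.shift μ)) (a μ (x.shift ν)) (a ν x) t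

/-- **The twisted Wilson action of the box along the line**: `W(t) = Σ_x Σ_{μ<ν} (N − Re tr(c_x(μ,ν) · linePlaq(t)))`, `c` the plaquette
twist phases. [cite: tHooft1979Flux, §2 (2.6)] [cite: GarciaperezGonzalezarroyoOkawa2017, §2.1–2.3] -/
def lineAction (c : FinTorusSite n₀ n₁ n₂ n₃ → Fin 4 → Fin 4 → ℂ) (t : ℝ) : ℝ :=
  ∑ x, ∑ q : {q : Fin 4 × Fin 4 // q.1 < q.2}, ((N : ℝ) - (c x q.1.1 q.1.2 • linePlaq U a x q.1.1 q.1.2 t).trace.re)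

/-- At `t = 0` the perturbed plaquette is the background plaquette. [folklore] -/
theorem linePlaq_zero (x : FinTorusSite n₀ n₁ n₂ n₃) (μ ν : Fin 4) : linePlaq U a x μ ν 0 = bgPlaq U x μ ν := by
  simp [linePlaq, bgPlaq, plaqHol]

end Line

/-! ## §2 First and second variation at a twist-eating unitary background -/

section Variation

/-- Conjugates of skew-Hermitian matrices by any `Γ` (with `Γᴴ` on the right) are skew-Hermitian. [folklore] -/
theorem conjTranspose_conj_of_skew {Γ X : Matrix (Fin N) (Fin N) ℂ} (hX : Xᴴ = -X) : (Γ * X * Γᴴ)ᴴ = -(Γ * X * Γᴴ) := by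
  rw [Matrix.conjTranspose_mul, Matrix.conjTranspose_mul, Matrix.conjTranspose_conjTranspose, hX, Matrix.neg_mul, Matrix.mul_neg,
    Matrix.mul_assoc]

variable {U : FinTorusSite n₀ n₁ n₂ n₃ × Fin 4 → Matrix (Fin N) (Fin N) ℂ} {c : FinTorusSite n₀ n₁ n₂ n₃ → Fin 4 → Fin 4 → ℂ}
  {a : Fin 4 → FinTorusSite n₀ n₁ n₂ n₃ → Matrix (Fin N) (Fin N) ℂ}

/-- The four transported insertions `Y₁, …, Y₄` of the plaquette `(x; μ, ν)` are `a_μ(x)`, `S_μ a_ν(x)`, `−S_ν a_μ(x)`, `−a_ν(x)`: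
`c · linePlaq(t) = e^{tY₁}e^{tY₂}e^{tY₃}e^{tY₄}` (lit-4's transport to the base point). [cite: GarciaperezGonzalezarroyoOkawa2017, §2.3 (2.3)] -/
theorem linePlaq_smul_eq_expWord4 (hU : ∀ e, U e ∈ Matrix.unitaryGroup (Fin N) ℂ)
    (hc : ∀ x μ ν, star (c x μ ν) * c x μ ν = 1)
    (heat : ∀ (x : FinTorusSite n₀ n₁ n₂ n₃) (μ ν : Fin 4), μ < ν → bgPlaq U x μ ν = star (c x μ ν) • (1 : Matrix (Fin N) (Fin N) ℂ))
    (hskew : ∀ μ x, (a μ x)ᴴ = -a μ x)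
    (x : FinTorusSite n₀ n₁ n₂ n₃) {μ ν : Fin 4} (hμν : μ < ν) (t : ℝ) :
    c x μ ν • linePlaq U a x μ ν t =
      expWord4 (a μ x) (covShift U μ (a ν) x) (-(covShift U ν (a μ) x)) (-(a ν x)) t := by
  have hc' : star (star (c x μ ν)) * star (c x μ ν) = 1 := by rw [star_star, mul_comm]; exact hc x μ ν
  have h := star_smul_plaqHol_eq_expWord4 (X₁ := a μ x) (X₂ := a ν (x.shift μ)) (hU (x, μ)).1 (hU (x, ν)).1
    (hskew μ (x.shift ν)) (hskew ν x) (heat x μ ν hμν) hc' t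
  rw [star_star] at h
  exact h

/-- **`W'(t)` everywhere**: minus the sum of lit-4's first-variation functions of the transported insertions.
[cite: ShenZhuZhuCMP2023, Lemma 4.1 proof] -/
theorem hasDerivAt_lineAction (hU : ∀ e, U e ∈ Matrix.unitaryGroup (Fin N) ℂ)
    (hc : ∀ x μ ν, star (c x μ ν) * c x μ ν = 1)
    (heat : ∀ (x : FinTorusSite n₀ n₁ n₂ n₃) (μ ν : Fin 4), μ < ν → bgPlaq U x μ ν = star (c x μ ν) • (1 : Matrix (Fin N) (Fin N) ℂ))
    (hskew : ∀ μ x, (a μ x)ᴴ = -a μ x) (t : ℝ) :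
    HasDerivAt (lineAction U a c)
      (∑ x, ∑ q : {q : Fin 4 × Fin 4 // q.1 < q.2},
        -firstVar (a q.1.1 x) (covShift U q.1.1 (a q.1.2) x) (-(covShift U q.1.2 (a q.1.1) x)) (-(a q.1.2 x)) t) t := by
  have h : HasDerivAt (fun s => ∑ x, ∑ q : {q : Fin 4 × Fin 4 // q.1 < q.2},
      ((N : ℝ) - (c x q.1.1 q.1.2 • linePlaq U a x q.1.1 q.1.2 s).trace.re)) _ t :=
    HasDerivAt.fun_sum fun x _ => HasDerivAt.fun_sum fun q _ => by
      have e : (fun s => (N : ℝ) - (c x q.1.1 q.1.2 • linePlaq U a x q.1.1 q.1.2 s).trace.re) = fun s =>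
          (N : ℝ) - (expWord4 (a q.1.1 x) (covShift U q.1.1 (a q.1.2) x) (-(covShift U q.1.2 (a q.1.1) x)) (-(a q.1.2 x)) s).trace.re := by
        funext s; rw [linePlaq_smul_eq_expWord4 hU hc heat hskew x q.2 s]
      rw [e]
      exact (hasDerivAt_re_trace_expWord4 _ _ _ _ t).const_sub (N : ℝ)
  exact h

/-- **`W(0) = 0`**: the twist eater has zero twisted action. [cite: GarciaperezGonzalezarroyoOkawa2017, §2.2] -/
theorem lineAction_zero (hc : ∀ x μ ν, star (c x μ ν) * c x μ ν = 1)
    (heat : ∀ (x : FinTorusSite n₀ n₁ n₂ n₃) (μ ν : Fin 4), μ < ν → bgPlaq U x μ ν = star (c x μ ν) • (1 : Matrix (Fin N) (Fin N) ℂ)) :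
    lineAction U a c 0 = 0 := by
  refine Finset.sum_eq_zero fun x _ => Finset.sum_eq_zero fun q _ => ?_
  rw [linePlaq_zero, heat x _ _ q.2, smul_smul, mul_comm, hc x _ _, one_smul, Matrix.trace_one, Fintype.card_fin, Complex.natCast_re,
    sub_self]

/-- **`W'(0) = 0`**: the twist eater is a critical point (no linear term along skew-Hermitian directions).
[cite: GarciaperezGonzalezarroyoOkawa2017, §2.2–2.3] -/
theorem deriv_lineAction_zero (hU : ∀ e, U e ∈ Matrix.unitaryGroup (Fin N) ℂ)
    (hc : ∀ x μ ν, star (c x μ ν) * c x μ ν = 1)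
    (heat : ∀ (x : FinTorusSite n₀ n₁ n₂ n₃) (μ ν : Fin 4), μ < ν → bgPlaq U x μ ν = star (c x μ ν) • (1 : Matrix (Fin N) (Fin N) ℂ))
    (hskew : ∀ μ x, (a μ x)ᴴ = -a μ x) :
    deriv (lineAction U a c) 0 = 0 := by
  rw [(hasDerivAt_lineAction hU hc heat hskew 0).deriv]
  refine Finset.sum_eq_zero fun x _ => Finset.sum_eq_zero fun q _ => ?_
  rw [firstVar_zero, neg_eq_zero]
  refine re_trace_eq_zero_of_skew ?_
  simp only [Matrix.conjTranspose_add, Matrix.conjTranspose_neg, hskew, covShift_apply, conjTranspose_conj_of_skew (hskew _ _)]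
  abel

/-- ★★ **THE HESSIAN OF THE TWISTED WILSON ACTION OF THE BOX AT A TWIST-EATING BACKGROUND IS THE COVARIANT CURL FORM.**  For a unitary
background `U` eating the twist phases `c` (`c·P_U = 1` on every plaquette) and a skew-Hermitian lattice 1-form `a`:
`W''(0) = Σ_x Σ_{μ<ν} S(∇⁺_μ a_ν − ∇⁺_ν a_μ)(x)`, `S(X) = Re tr(XᴴX)`, `∇⁺_μ` the adjoint covariant difference of `…TwistedSlabCovariantCalculus`.
[cite: GarciaperezGonzalezarroyoOkawa2017, §2.3 (`G_{μν}(n) = ∇⁺_μA_ν(n) − ∇⁺_νA_μ(n) + O(g)`; quadratic part of the action)] [cite: ShenZhuZhuCMP2023, (4.3)] -/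
theorem iteratedDeriv_two_lineAction (hU : ∀ e, U e ∈ Matrix.unitaryGroup (Fin N) ℂ)
    (hc : ∀ x μ ν, star (c x μ ν) * c x μ ν = 1)
    (heat : ∀ (x : FinTorusSite n₀ n₁ n₂ n₃) (μ ν : Fin 4), μ < ν → bgPlaq U x μ ν = star (c x μ ν) • (1 : Matrix (Fin N) (Fin N) ℂ))
    (hskew : ∀ μ x, (a μ x)ᴴ = -a μ x) :
    iteratedDeriv 2 (lineAction U a c) 0 =
      ∑ x, ∑ q : {q : Fin 4 × Fin 4 // q.1 < q.2}, ((((covDeriv U q.1.1 (a q.1.2) x - covDeriv U q.1.2 (a q.1.1) x))ᴴ *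
        (covDeriv U q.1.1 (a q.1.2) x - covDeriv U q.1.2 (a q.1.1) x)).trace).re := by
  have hderiv : deriv (lineAction U a c) = fun t => ∑ x, ∑ q : {q : Fin 4 × Fin 4 // q.1 < q.2},
      -firstVar (a q.1.1 x) (covShift U q.1.1 (a q.1.2) x) (-(covShift U q.1.2 (a q.1.1) x)) (-(a q.1.2 x)) t :=
    funext fun t => (hasDerivAt_lineAction hU hc heat hskew t).deriv
  have hd2 : HasDerivAt (fun t => ∑ x, ∑ q : {q : Fin 4 × Fin 4 // q.1 < q.2},
      -firstVar (a q.1.1 x) (covShift U q.1.1 (a q.1.2) x) (-(covShift U q.1.2 (a q.1.1) x)) (-(a q.1.2 x)) t)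
      (∑ x, ∑ q : {q : Fin 4 × Fin 4 // q.1 < q.2},
        -((((a q.1.1 x + covShift U q.1.1 (a q.1.2) x + -(covShift U q.1.2 (a q.1.1) x) + -(a q.1.2 x)) *
          (a q.1.1 x + covShift U q.1.1 (a q.1.2) x + -(covShift U q.1.2 (a q.1.1) x) + -(a q.1.2 x))).trace).re)) 0 :=
    HasDerivAt.fun_sum fun x _ => HasDerivAt.fun_sum fun q _ => (hasDerivAt_firstVar_zero _ _ _ _).neg
  rw [iteratedDeriv_succ, iteratedDeriv_one, hderiv, hd2.deriv]
  refine Finset.sum_congr rfl fun x _ => Finset.sum_congr rfl fun q _ => ?_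
  have hZ : (a q.1.1 x + covShift U q.1.1 (a q.1.2) x + -(covShift U q.1.2 (a q.1.1) x) + -(a q.1.2 x))ᴴ =
      -(a q.1.1 x + covShift U q.1.1 (a q.1.2) x + -(covShift U q.1.2 (a q.1.1) x) + -(a q.1.2 x)) := by
    simp only [Matrix.conjTranspose_add, Matrix.conjTranspose_neg, hskew, covShift_apply, conjTranspose_conj_of_skew (hskew _ _)]
    abel
  rw [re_trace_sq_of_skew hZ, neg_neg]
  have he : a q.1.1 x + covShift U q.1.1 (a q.1.2) x + -(covShift U q.1.2 (a q.1.1) x) + -(a q.1.2 x) =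
      covDeriv U q.1.1 (a q.1.2) x - covDeriv U q.1.2 (a q.1.1) x := by
    simp only [covDeriv]; abel
  rw [he]

end Variation

/-! ## §3 The Coulomb-gauge Hessian gap -/

section Gap

variable {U : FinTorusSite n₀ n₁ n₂ n₃ × Fin 4 → Matrix (Fin N) (Fin N) ℂ} {c : FinTorusSite n₀ n₁ n₂ n₃ → Fin 4 → Fin 4 → ℂ}
  {a : Fin 4 → FinTorusSite n₀ n₁ n₂ n₃ → Matrix (Fin N) (Fin N) ℂ}

/-- ★★ **Hessian gap on the Coulomb slice from a 0-form gap** (any phase-flat unitary background eating the twist phases `c`): if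
`m·Σ_x S(Φ x) ≤ Σ_x Σ_μ S(∇⁺_μ Φ)(x)` for traceless `Φ`, then `m · Σ_x Σ_μ S(a_μ x) ≤ W''(0)` along every traceless skew-Hermitian `a` with
`div a = 0`. [cite: GarciaperezGonzalezarroyoOkawa2017, §2.2 («the irreducibility condition eliminates the presence of zero-modes»), §2.5] -/
theorem lineAction_hessian_gap_of_zeroForm_gap (hU : ∀ e, U e ∈ Matrix.unitaryGroup (Fin N) ℂ) (hflat : IsPhaseFlat U)
    (hc : ∀ x μ ν, star (c x μ ν) * c x μ ν = 1)
    (heat : ∀ (x : FinTorusSite n₀ n₁ n₂ n₃) (μ ν : Fin 4), μ < ν → bgPlaq U x μ ν = star (c x μ ν) • (1 : Matrix (Fin N) (Fin N) ℂ))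
    {m : ℝ}
    (hgap : ∀ Φ : FinTorusSite n₀ n₁ n₂ n₃ → Matrix (Fin N) (Fin N) ℂ, (∀ x, (Φ x).trace = 0) →
      m * ∑ x, (((Φ x)ᴴ * Φ x).trace).re ≤ ∑ x, ∑ μ, (((covDeriv U μ Φ x)ᴴ * covDeriv U μ Φ x).trace).re)
    (hskew : ∀ μ x, (a μ x)ᴴ = -a μ x) (htr : ∀ μ x, (a μ x).trace = 0) (hdiv : ∀ x, covDiv U a x = 0) :
    m * ∑ x, ∑ μ, (((a μ x)ᴴ * a μ x).trace).re ≤ iteratedDeriv 2 (lineAction U a c) 0 := by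
  rw [iteratedDeriv_two_lineAction hU hc heat hskew]
  exact coulomb_gap_of_zeroForm_gap hU hflat hgap a htr hdiv

variable {A B : Matrix (Fin N) (Fin N) ℂ} {ω : ℂ}

/-- The decorated ladder `![A, B, c₂·1, c₃·1]` of unitaries `A, B` and phases `c₂, c₃` is a unitary link field. [folklore] -/
theorem ladderField_pair_mem_unitaryGroup {n₀ n₁ n₂ n₃ : ℕ} (hAu : A ∈ Matrix.unitaryGroup (Fin N) ℂ) (hBu : B ∈ Matrix.unitaryGroup (Fin N) ℂ)
    {c₂ c₃ : ℂ} (hc₂ : star c₂ * c₂ = 1) (hc₃ : star c₃ * c₃ = 1) (e : FinTorusSite n₀ n₁ n₂ n₃ × Fin 4) :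
    ladderField ![A, B, c₂ • (1 : Matrix (Fin N) (Fin N) ℂ), c₃ • (1 : Matrix (Fin N) (Fin N) ℂ)] e ∈
      Matrix.unitaryGroup (Fin N) ℂ := by
  have hsm : ∀ {z : ℂ}, star z * z = 1 → z • (1 : Matrix (Fin N) (Fin N) ℂ) ∈ Matrix.unitaryGroup (Fin N) ℂ := fun {z} hz => by
    rw [Matrix.mem_unitaryGroup_iff, Matrix.star_eq_conjTranspose, Matrix.conjTranspose_smul, Matrix.conjTranspose_one,
      Matrix.smul_mul, Matrix.one_mul, smul_smul, mul_comm, hz, one_smul]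
  refine ladderField_mem_unitaryGroup (fun μ => ?_) e
  fin_cases μ
  · exact hAu
  · exact hBu
  · exact hsm hc₂
  · exact hsm hc₃

variable [NeZero N] {m : ℕ}

/-- ★★★ **COULOMB-GAUGE HESSIAN GAP AT THE DECORATED TWIST-EATING LADDERS, UNIFORM IN THE LONG EXTENTS.**  Let `A, B` be a unitary
Weyl pair `AB = ω·BA` (`ω` a primitive `N`-th root of unity), `c₂, c₃` phases, `U = ladderField ![A, B, c₂·1, c₃·1]` on the box
`(m+1) × (m+1) × n₂ × n₃`, and `c` twist phases EATEN by `U` (`c·P_U = 1` on every plaquette).  Then along every traceless skew-Hermitian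
lattice 1-form `a` on the Coulomb slice `div a = 0`:
`4 sin²(π/(N(m+1))) · Σ_x Σ_μ S(a_μ x) ≤ W''(0)` —
the Hessian of the twisted Wilson action of the box at the classical vacuum, restricted to the gauge slice, has no zero mode and gap the
square of the smallest twisted momentum, for EVERY `n₂, n₃` (transversal Morse–Bott non-degeneracy of the critical orbits of
`…TwistedSlabVacuumOrbits`, with an (L, T)-uniform constant). [cite: GarciaperezGonzalezarroyoOkawa2017, §2.2, §2.3, §2.5]
[cite: GarciaperezGonzalezarroyoOkawa2014, §3] -/
theorem ladder_hessian_gap {n₂ n₃ : ℕ} (hAu : A ∈ Matrix.unitaryGroup (Fin N) ℂ) (hBu : B ∈ Matrix.unitaryGroup (Fin N) ℂ)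
    (hω : IsPrimitiveRoot ω N) (hAB : A * B = ω • (B * A)) {c₂ c₃ : ℂ} (hc₂ : star c₂ * c₂ = 1) (hc₃ : star c₃ * c₃ = 1)
    {c : FinTorusSite (m + 1) (m + 1) n₂ n₃ → Fin 4 → Fin 4 → ℂ} (hc : ∀ x μ ν, star (c x μ ν) * c x μ ν = 1)
    (heat : ∀ (x : FinTorusSite (m + 1) (m + 1) n₂ n₃) (μ ν : Fin 4), μ < ν →
      bgPlaq (ladderField ![A, B, c₂ • (1 : Matrix (Fin N) (Fin N) ℂ), c₃ • (1 : Matrix (Fin N) (Fin N) ℂ)]) x μ ν =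
        star (c x μ ν) • (1 : Matrix (Fin N) (Fin N) ℂ))
    {a : Fin 4 → FinTorusSite (m + 1) (m + 1) n₂ n₃ → Matrix (Fin N) (Fin N) ℂ}
    (hskew : ∀ μ x, (a μ x)ᴴ = -a μ x) (htr : ∀ μ x, (a μ x).trace = 0)
    (hdiv : ∀ x, covDiv (ladderField ![A, B, c₂ • (1 : Matrix (Fin N) (Fin N) ℂ), c₃ • (1 : Matrix (Fin N) (Fin N) ℂ)]) a x = 0) :
    4 * Real.sin (Real.pi / ((N : ℝ) * (m + 1 : ℕ))) ^ 2 * ∑ x, ∑ μ, (((a μ x)ᴴ * a μ x).trace).re ≤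
      iteratedDeriv 2 (lineAction (ladderField ![A, B, c₂ • (1 : Matrix (Fin N) (Fin N) ℂ), c₃ • (1 : Matrix (Fin N) (Fin N) ℂ)]) a c) 0 :=
  lineAction_hessian_gap_of_zeroForm_gap (ladderField_pair_mem_unitaryGroup hAu hBu hc₂ hc₃)
    (isPhaseFlat_ladderField_pair (NeZero.ne N) hω.pow_eq_one hAB c₂ c₃) hc heat
    (fun Φ hΦ => zeroForm_gap_ladder hAu hBu hω hAB _ _ Φ hΦ) hskew htr hdiv

end Gap

end Summit.QuantumFields.YangMills.Cruxes.IRcof.TwistedSlab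

end
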